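import Literature.AlgebraicGeometry.Limits.FiniteEtaleSpread
import Literature.AlgebraicGeometry.Motives.AlgPointsFibre
import Literature.AlgebraicGeometry.Motives.ComplexPointsFiniteEtaleCovering
import Literature.AlgebraicGeometry.Motives.ComplexPointsManifold
import Literature.AlgebraicGeometry.Motives.BaseChangePointsProofs
import Literature.AlgebraicGeometry.Motives.CyclesBaseChange
import Literature.AlgebraicGeometry.Motives.GeometricallyIntegralAlgClosed
import Literature.AlgebraicGeometry.Motives.AbelianVarietyProofs
import Literature.AlgebraicGeometry.HodgeTheory.GlobalInvariantCyclesProofs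
import Literature.NumberTheory.Transcendental.AnalytificationConnectedProofs
import Literature.Topology.CoveringSpaces.CoveringSliceTransport
import Mathlib.AlgebraicGeometry.AlgClosed.Basic
import HarnessLib

/-!
# Finite étale covers of `S₀ ⊗_{ℚ̄} ℂ` come from `ℚ̄` up to homeomorphism of complex points

Topic: `Literature/AlgebraicGeometry/FundamentalGroup`. The **weak descent** input `hDescent` of
`HodgeTheory.finiteCovering_descends_to_qbar_of_riemannExistence_of_weakDescent` (and hence of
`FundamentalGroup.riemannExistence_qbarDescent_of_finiteIndex_of_riemannExistence_of_weakDescent`),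
PROVED: for `K` algebraically closed (e.g. `ℚ̄`), `σ : K → ℂ`, `S₀` smooth irreducible and
quasi-projective over `K` and `g : S' → S₀ ⊗_σ ℂ` finite étale, there are a finite étale
`g₀ : S''₀ → S₀` over `K` and a homeomorphism `Ψ : (S''₀ ⊗_σ ℂ)(ℂ) ≃ₜ S'(ℂ)` with
`g ∘ Ψ = g₀ ⊗_σ ℂ` on complex points (`finiteEtaleCover_weakDescent`).

Proof (SGA1 XIII / Voisin 2007 §3, "spreading out and moving the base point"):
1. *Spreading out* (`Limits.exists_finite_etale_spread_smooth`, EGA IV₃ 8.8.2, 8.10.5, IV₄ 17.7.8):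
   `g` is the base change along `ψ : R ↪ ℂ` of a finite étale `G : X' → S₀ ×_K U`, `U = Spec R` a
   smooth affine `K`-variety.
2. *The family of covers on complex points*: `X'(ℂ) → S₀(ℂ) × U(ℂ)` is a finite covering map
   (`ComplexPoints.isCoveringMap_map_of_isFinite`, transported along `X(ℂ) ≃ₜ X_σ(ℂ)`), and `U(ℂ)`
   is path connected (`U ⊗_σ ℂ` is irreducible as `K = K̄`, its complex points form a connected
   complex manifold).
3. *Moving the base point* (`Topology.exists_sliceHomeomorph`, Hatcher Prop. 1.30/4.61): the slices
   of the covering over the very general point `u₁ = ψ ∈ U(ℂ)` and over a `K`-point `u₀ ∈ U(K)` are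
   homeomorphic over `S₀(ℂ)`; by `AlgPoints.fibreHomeomorph` these slices are the complex points of
   the fibres `X'_{u₁} ≅ S'` and `X'_{u₀} ⊗_σ ℂ`, and `S''₀ := X'_{u₀} → S₀` is finite étale.

Everything is proved; no named facts.

## References

* A. Grothendieck, SGA 1, Exp. XIII §4 (specialisation of the fundamental group), Exp. XII
  Thm. 5.1. [SGA1]
* C. Voisin, *Hodge loci and absolute Hodge classes*, Compos. Math. 143 (2007), §3. [Voisin2007]
* A. Hatcher, *Algebraic Topology* (2002), §1.3 Prop. 1.30–1.31, §4.3 Prop. 4.61. [HatcherAT2002]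
* A. Grothendieck, J. Dieudonné, EGA IV₃ 8.8.2, 8.10.5; EGA IV₄ 17.7.8. [EGAIV3] [EGAIV4]
-/

noncomputable section

open CategoryTheory CategoryTheory.Limits AlgebraicGeometry Topology MonoidalCategory

set_option backward.isDefEq.respectTransparency false

namespace Literature.AlgebraicGeometry.FundamentalGroup

open Literature.AlgebraicGeometry.Motives Literature.Topology Literature.Topology.CoveringSpaces

/-- Over a locally Noetherian base, locally of finite type implies locally of finite presentation
(same statement and proof as `HodgeTheory.locallyOfFinitePresentation_of_isLocallyNoetherian`, kept
private here). [folklore] -/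
private theorem locallyOfFinitePresentation_of_isLocallyNoetherian'' {X Y : Scheme.{0}} (g : X ⟶ Y)
    [IsLocallyNoetherian Y] [LocallyOfFiniteType g] : LocallyOfFinitePresentation g := by
  rw [HasRingHomProperty.iff_appLE (P := @LocallyOfFinitePresentation)]
  intro U V e
  haveI := IsLocallyNoetherian.component_noetherian (X := Y) U
  exact RingHom.FinitePresentation.of_finiteType.mp
    (HasRingHomProperty.appLE @LocallyOfFiniteType g inferInstance U V e)

/-! ### Generalities on complex points of base changes -/

section Generalities

variable {K : Type} [Field K] (σ : K →+* ℂ)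

/-- A complex point of `X_σ` (over `ℂ`) is determined by its composite with `π : X_σ → X`. [folklore] -/
theorem ComplexPoints.ext_of_left_comp_baseChangeHomFst (X : SchemeOver K)
    {Q Q' : ComplexPoints ((baseChangeHom σ).obj X)}
    (h : Q.left ≫ baseChangeHomFst σ X = Q'.left ≫ baseChangeHomFst σ X) : Q = Q' := by
  apply Over.OverMorphism.ext
  apply pullback.hom_ext
  · exact h
  · exact (AlgPoints.left_comp_hom_eq_id Q).trans (AlgPoints.left_comp_hom_eq_id Q').symm

/-- The homeomorphism `X(ℂ) ≃ₜ X_σ(ℂ)` (`AlgPoints.baseChangeEquiv`, a homeomorphism by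
`AlgPoints.isHomeomorph_baseChangeEquiv_holds`). [folklore] -/
def bcHomeomorph (X : SchemeOver K) :
    letI := σ.toAlgebra; ComplexPoints X ≃ₜ ComplexPoints ((baseChangeHom σ).obj X) :=
  letI := σ.toAlgebra
  Homeomorph.mk (AlgPoints.baseChangeEquiv σ X) (AlgPoints.continuous_baseChangeEquiv σ X)
    (AlgPoints.continuous_baseChangeEquiv_symm σ X)

/-- `bcHomeomorph` is `baseChangeEquiv` (by `rfl`). [folklore] -/
theorem bcHomeomorph_apply (X : SchemeOver K) (P : letI := σ.toAlgebra; ComplexPoints X) :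
    letI := σ.toAlgebra; bcHomeomorph σ X P = AlgPoints.baseChangeEquiv σ X P := rfl

/-- The inverse of `bcHomeomorph` is `baseChangeEquiv.symm` (by `rfl`). [folklore] -/
theorem bcHomeomorph_symm_apply (X : SchemeOver K) (Q : ComplexPoints ((baseChangeHom σ).obj X)) :
    letI := σ.toAlgebra; (bcHomeomorph σ X).symm Q = (AlgPoints.baseChangeEquiv σ X).symm Q := rfl

/-- Naturality of `X_σ(ℂ) → X(ℂ)` in `X` (same proof as `HodgeTheory.baseChangeEquiv_symm_map`). [folklore] -/
theorem baseChangeEquiv_symm_map' {X Y : SchemeOver K} (f : X ⟶ Y)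
    (u : ComplexPoints ((baseChangeHom σ).obj X)) :
    (letI := σ.toAlgebra
     (AlgPoints.baseChangeEquiv σ Y).symm (AlgPoints.map ((baseChangeHom σ).map f) u) =
      AlgPoints.map f ((AlgPoints.baseChangeEquiv σ X).symm u)) := by
  letI := σ.toAlgebra
  apply Over.OverMorphism.ext
  rw [AlgPoints.baseChangeEquiv_symm_apply_left, AlgPoints.map_apply, Over.comp_left,
    AlgPoints.map_apply, Over.comp_left, AlgPoints.baseChangeEquiv_symm_apply_left, Category.assoc,
    baseChangeHom_map_left_comp_fst, Category.assoc]

/-- **A morphism of `K`-schemes whose complexification is a covering map on complex points is a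
covering map on complex points** (transport along the homeomorphisms `X(ℂ) ≃ₜ X_σ(ℂ)`). [folklore] -/
theorem isCoveringMap_map_of_baseChangeHom {X Y : SchemeOver K} (f : X ⟶ Y)
    (h : IsCoveringMap (AlgPoints.map ((baseChangeHom σ).map f) :
      ComplexPoints ((baseChangeHom σ).obj X) → ComplexPoints ((baseChangeHom σ).obj Y))) :
    letI := σ.toAlgebra
    IsCoveringMap (AlgPoints.map f : ComplexPoints X → ComplexPoints Y) := by
  letI := σ.toAlgebra
  have hfun : (AlgPoints.map f : ComplexPoints X → ComplexPoints Y) =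
      (bcHomeomorph σ Y).symm ∘ AlgPoints.map ((baseChangeHom σ).map f) ∘ bcHomeomorph σ X := by
    funext P
    change _ = (AlgPoints.baseChangeEquiv σ Y).symm
      (AlgPoints.map ((baseChangeHom σ).map f) (AlgPoints.baseChangeEquiv σ X P))
    rw [baseChangeEquiv_symm_map', Equiv.symm_apply_apply]
  rw [hfun]
  exact (h.comp_homeomorph _).homeomorph_comp _

/-- The homeomorphism of complex points induced by an isomorphism of `ℂ`-schemes. [folklore] -/
def homeomorphOfIso' {k : Type} [Field k] [Algebra k ℂ] {X Y : SchemeOver k} (e : X ≅ Y) :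
    ComplexPoints X ≃ₜ ComplexPoints Y where
  toFun := AlgPoints.map e.hom
  invFun := AlgPoints.map e.inv
  left_inv P := by rw [← AlgPoints.map_comp_apply, e.hom_inv_id, AlgPoints.map_id_apply]
  right_inv Q := by rw [← AlgPoints.map_comp_apply, e.inv_hom_id, AlgPoints.map_id_apply]
  continuous_toFun := AlgPoints.continuous_map _
  continuous_invFun := AlgPoints.continuous_map _

/-- `homeomorphOfIso' e` is `map e.hom` (by `rfl`). [folklore] -/
@[simp]
theorem homeomorphOfIso'_apply {k : Type} [Field k] [Algebra k ℂ] {X Y : SchemeOver k} (e : X ≅ Y)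
    (P : ComplexPoints X) : homeomorphOfIso' e P = AlgPoints.map e.hom P := rfl

/-- The inverse of `homeomorphOfIso' e` is `map e.inv` (by `rfl`). [folklore] -/
@[simp]
theorem homeomorphOfIso'_symm_apply {k : Type} [Field k] [Algebra k ℂ] {X Y : SchemeOver k}
    (e : X ≅ Y) (Q : ComplexPoints Y) : (homeomorphOfIso' e).symm Q = AlgPoints.map e.inv Q := rfl

end Generalities

/-! ### Complex points of a smooth affine `K`-variety are path connected -/

section PathConnected

variable {K : Type} [Field K] [IsAlgClosed K] (σ : K →+* ℂ) (R : Type) [CommRing R] [IsDomain R]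
  [Algebra K R] [Algebra.FiniteType K R]

/-- **`(Spec R)(ℂ)` is path connected** for `R` a domain of finite type over the algebraically closed
`K ⊆ ℂ` with `Spec R → Spec K` smooth: `Spec R ⊗_σ ℂ` is irreducible (`K = K̄`: integral ⇒
geometrically integral, `Motives.geometricallyIntegral_of_isAlgClosed`), so its complex points are
connected (`ComplexPoints.connectedSpace_iff`, SGA1 XII 2.4) and they form a topological manifold
(`ComplexPoints.chartedSpace`), hence a path-connected space; and `(Spec R)(ℂ) ≃ₜ (Spec R ⊗_σ ℂ)(ℂ)`.
[cite: SGA1, Exp. XII Prop. 2.4] -/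
theorem pathConnectedSpace_complexPoints_specOver [Smooth (specOver K R).hom] :
    letI := σ.toAlgebra; PathConnectedSpace (ComplexPoints (specOver K R)) := by
  letI := σ.toAlgebra
  set U : SchemeOver K := specOver K R
  haveI : LocallyOfFiniteType U.hom := by
    change LocallyOfFiniteType (Spec.map (CommRingCat.ofHom (algebraMap K R)))
    rw [HasRingHomProperty.Spec_iff (P := @LocallyOfFiniteType)]
    exact RingHom.finiteType_algebraMap.mpr ‹_›
  haveI : IrreducibleSpace U.left := inferInstanceAs (IrreducibleSpace (PrimeSpectrum R))
  haveI : IsIntegral U.left := inferInstanceAs (IsIntegral (Spec (.of R)))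
  haveI : GeometricallyIntegral U.hom := geometricallyIntegral_of_isAlgClosed U.hom
  obtain ⟨r, hr⟩ := exists_smoothOfRelativeDimension_of_smooth U.hom
  set Uc : SchemeOver ℂ := (baseChangeHom σ).obj U
  haveI : LocallyOfFiniteType Uc.hom :=
    inferInstanceAs (LocallyOfFiniteType (pullback.snd U.hom (Spec.map (CommRingCat.ofHom σ))))
  haveI := smoothOfRelativeDimension_isStableUnderBaseChange r
  haveI : SmoothOfRelativeDimension r Uc.hom :=
    MorphismProperty.pullback_snd (P := @SmoothOfRelativeDimension r) U.hom
      (Spec.map (CommRingCat.ofHom σ)) hr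
  haveI : GeometricallyIrreducible Uc.hom :=
    inferInstanceAs (GeometricallyIrreducible (pullback.snd U.hom (Spec.map (CommRingCat.ofHom σ))))
  haveI : Nonempty Uc.left := by
    haveI : Surjective (baseChangeHomFst σ U) :=
      inferInstanceAs (Surjective (pullback.fst U.hom (Spec.map (CommRingCat.ofHom σ))))
    obtain ⟨y, -⟩ := (baseChangeHomFst σ U).surjective (Nonempty.some inferInstance)
    exact ⟨y⟩
  haveI : IrreducibleSpace Uc.left := GeometricallyIrreducible.irreducibleSpace_of_subsingleton Uc.hom
  haveI : ConnectedSpace (ComplexPoints Uc) := (ComplexPoints.connectedSpace_iff_holds Uc).mpr inferInstance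
  haveI : LocallyPathConnectedSpace (ComplexPoints Uc) := by
    letI := ComplexPoints.chartedSpace Uc r
    exact ChartedSpace.locallyPathConnectedSpace (EuclideanSpace ℝ (Fin (2 * r))) _
  haveI : PathConnectedSpace (ComplexPoints Uc) := pathConnectedSpace_iff_connectedSpace.mpr inferInstance
  exact (bcHomeomorph σ U).symm.surjective.pathConnectedSpace (bcHomeomorph σ U).symm.continuous

end PathConnected

/-! ### The family of covers `X' → S₀ ×_K U` on complex points -/

section Family

namespace SpreadFamily

variable {K : Type} [Field K] (S₀ : SchemeOver K) (R : Type) [CommRing R]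
  [Algebra K R] {X' : Scheme.{0}} (G : X' ⟶ (S₀ ⊗ specOver K R).left)

/-- The total space `X'` of `G : X' → S₀ ×_K U`, `U = Spec R`, as a `K`-scheme through `U`. [folklore] -/
def total : SchemeOver K :=
  Over.mk ((G ≫ pullback.snd S₀.hom (specOver K R).hom) ≫ (specOver K R).hom)

/-- `G` as a `K`-morphism `X' → S₀ ×_K U`. [folklore] -/
def toProd : total S₀ R G ⟶ S₀ ⊗ specOver K R :=
  Over.homMk G (by
    change G ≫ (pullback.fst S₀.hom (specOver K R).hom ≫ S₀.hom) =
      (G ≫ pullback.snd S₀.hom (specOver K R).hom) ≫ (specOver K R).hom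
    rw [pullback.condition, Category.assoc])

/-- The underlying morphism of `toProd` is `G` (by `rfl`). [folklore] -/
@[simp]
theorem toProd_left : (toProd S₀ R G).left = G := rfl

/-- The projection `X' → U` over `K`. [folklore] -/
def toBase : total S₀ R G ⟶ specOver K R := toProd S₀ R G ≫ CartesianMonoidalCategory.snd _ _

/-- The underlying morphism of `toBase` (by `rfl`). [folklore] -/
@[simp]
theorem toBase_left : (toBase S₀ R G).left = G ≫ pullback.snd S₀.hom (specOver K R).hom := rfl

/-- The projection `X' → S₀` over `K`. [folklore] -/
def toS₀ : total S₀ R G ⟶ S₀ := toProd S₀ R G ≫ CartesianMonoidalCategory.fst _ _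

/-- The underlying morphism of `toS₀` (by `rfl`). [folklore] -/
@[simp]
theorem toS₀_left : (toS₀ S₀ R G).left = G ≫ pullback.fst S₀.hom (specOver K R).hom := rfl

variable [Algebra K ℂ]

/-- **The family of covers on complex points**: `X'(ℂ) → S₀(ℂ) × U(ℂ)`. [folklore] -/
def proj : ComplexPoints (total S₀ R G) → ComplexPoints S₀ × ComplexPoints (specOver K R) :=
  fun e ↦ AlgPoints.prodEquiv (AlgPoints.map (toProd S₀ R G) e)

/-- First component of `proj`. [folklore] -/
theorem proj_fst (e : ComplexPoints (total S₀ R G)) :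
    (proj S₀ R G e).1 = AlgPoints.map (toS₀ S₀ R G) e := by
  change AlgPoints.map _ (AlgPoints.map _ e) = _
  rw [← AlgPoints.map_comp_apply]
  rfl

/-- Second component of `proj`. [folklore] -/
theorem proj_snd (e : ComplexPoints (total S₀ R G)) :
    (proj S₀ R G e).2 = AlgPoints.map (toBase S₀ R G) e := by
  change AlgPoints.map _ (AlgPoints.map _ e) = _
  rw [← AlgPoints.map_comp_apply]
  rfl

/-- `proj` is continuous. [folklore] -/
theorem continuous_proj : Continuous (proj S₀ R G) :=
  AlgPoints.continuous_prodEquiv.comp (AlgPoints.continuous_map _)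

/-- The slices of `proj` are the sets of complex points of `X'` over a given point of `U`. [folklore] -/
theorem slice_proj (u : ComplexPoints (specOver K R)) :
    slice (proj S₀ R G) u = {e | AlgPoints.map (toBase S₀ R G) e = u} := by
  ext e
  rw [mem_slice_iff, proj_snd]
  rfl

/-- **`X'(ℂ) → S₀(ℂ) × U(ℂ)` is a covering map** for `G` finite étale, `S₀` and `U` smooth of some
relative dimensions, separated and locally of finite type over `K`: its complexification is
(`ComplexPoints.isCoveringMap_map_of_isFinite`), and `X(ℂ) ≃ₜ X_ℂ(ℂ)`, `(S₀ ×_K U)(ℂ) ≃ₜ S₀(ℂ) × U(ℂ)`.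
[cite: SGA1, Exp. XII Prop. 3.2 (vi) and Thm. 5.1] -/
theorem isCoveringMap_proj [IsSeparated S₀.hom] [LocallyOfFiniteType S₀.hom]
    [LocallyOfFiniteType (specOver K R).hom] {d r : ℕ} (hd : SmoothOfRelativeDimension d S₀.hom)
    (hr : SmoothOfRelativeDimension r (specOver K R).hom) [IsFinite G] [Etale G] :
    IsCoveringMap (proj S₀ R G) := by
  set σ : K →+* ℂ := algebraMap K ℂ
  haveI := hd
  haveI := hr
  haveI : IsSeparated (specOver K R).hom :=
    inferInstanceAs (IsSeparated (Spec.map (CommRingCat.ofHom (algebraMap K R))))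
  -- smoothness and separatedness of the two structure maps over `K`
  haveI := smoothOfRelativeDimension_isStableUnderBaseChange r
  haveI := smoothOfRelativeDimension_isStableUnderBaseChange d
  haveI := smoothOfRelativeDimension_isStableUnderBaseChange (r + d)
  haveI : SmoothOfRelativeDimension r (pullback.fst S₀.hom (specOver K R).hom) :=
    MorphismProperty.pullback_fst (P := @SmoothOfRelativeDimension r) _ _ hr
  haveI : SmoothOfRelativeDimension d (pullback.snd S₀.hom (specOver K R).hom) :=
    MorphismProperty.pullback_snd (P := @SmoothOfRelativeDimension d) _ _ hd
  have hY : SmoothOfRelativeDimension (r + d) (S₀ ⊗ specOver K R).hom :=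
    inferInstanceAs (SmoothOfRelativeDimension (r + d) (pullback.fst S₀.hom (specOver K R).hom ≫ S₀.hom))
  have hX : SmoothOfRelativeDimension (r + d) (total S₀ R G).hom := by
    have h : SmoothOfRelativeDimension (0 + d + r)
        ((G ≫ pullback.snd S₀.hom (specOver K R).hom) ≫ (specOver K R).hom) := inferInstance
    have e : 0 + d + r = r + d := by omega
    rw [e] at h
    exact h
  haveI : IsSeparated (total S₀ R G).hom :=
    inferInstanceAs (IsSeparated ((G ≫ pullback.snd S₀.hom (specOver K R).hom) ≫ (specOver K R).hom))
  haveI : LocallyOfFiniteType (total S₀ R G).hom :=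
    inferInstanceAs (LocallyOfFiniteType ((G ≫ pullback.snd S₀.hom (specOver K R).hom) ≫ (specOver K R).hom))
  haveI : LocallyOfFiniteType (S₀ ⊗ specOver K R).hom :=
    inferInstanceAs (LocallyOfFiniteType (pullback.fst S₀.hom (specOver K R).hom ≫ S₀.hom))
  -- the complexified family
  set Xc : SchemeOver ℂ := (baseChangeHom σ).obj (total S₀ R G)
  set Yc : SchemeOver ℂ := (baseChangeHom σ).obj (S₀ ⊗ specOver K R)
  haveI : LocallyOfFiniteType Xc.hom := inferInstanceAs
    (LocallyOfFiniteType (pullback.snd (total S₀ R G).hom (Spec.map (CommRingCat.ofHom σ))))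
  haveI : LocallyOfFiniteType Yc.hom := inferInstanceAs
    (LocallyOfFiniteType (pullback.snd (S₀ ⊗ specOver K R).hom (Spec.map (CommRingCat.ofHom σ))))
  haveI : SmoothOfRelativeDimension (r + d) Xc.hom :=
    MorphismProperty.pullback_snd (P := @SmoothOfRelativeDimension (r + d)) _ _ hX
  haveI : SmoothOfRelativeDimension (r + d) Yc.hom :=
    MorphismProperty.pullback_snd (P := @SmoothOfRelativeDimension (r + d)) _ _ hY
  haveI : IsSeparated Xc.hom := inferInstanceAs
    (IsSeparated (pullback.snd (total S₀ R G).hom (Spec.map (CommRingCat.ofHom σ))))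
  have hsqc := isPullback_baseChangeHom_map_left σ (toProd S₀ R G)
  haveI : IsFinite ((baseChangeHom σ).map (toProd S₀ R G)).left :=
    MorphismProperty.of_isPullback (P := @IsFinite) hsqc (inferInstance : IsFinite G)
  haveI : Smooth ((baseChangeHom σ).map (toProd S₀ R G)).left :=
    MorphismProperty.of_isPullback (P := @Smooth) hsqc (inferInstance : Smooth G)
  have hc : IsCoveringMap (AlgPoints.map ((baseChangeHom σ).map (toProd S₀ R G)) :
      ComplexPoints Xc → ComplexPoints Yc) :=
    (ComplexPoints.isCoveringMap_map_of_isFinite (r + d) ((baseChangeHom σ).map (toProd S₀ R G))).1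
  have hK : IsCoveringMap (AlgPoints.map (toProd S₀ R G) :
      ComplexPoints (total S₀ R G) → ComplexPoints (S₀ ⊗ specOver K R)) :=
    isCoveringMap_map_of_baseChangeHom σ (toProd S₀ R G) hc
  exact hK.homeomorph_comp
    (Homeomorph.mk AlgPoints.prodEquiv AlgPoints.continuous_prodEquiv AlgPoints.continuous_prodEquiv_symm)

/-- **Moving the base point**: for `G` finite étale over `S₀ ×_K U` with `U = Spec R` a smooth affine
variety over the algebraically closed `K ⊆ ℂ` and `S₀` smooth, the fibres `X'_u`, `X'_v` over any two
complex points `u, v ∈ U(ℂ)` have homeomorphic complex points, compatibly with the projections to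
`S₀(ℂ)` (path-lifting in the covering `X'(ℂ) → S₀(ℂ) × U(ℂ)` along a path from `u` to `v` in the
path-connected `U(ℂ)`). [cite: HatcherAT2002, §1.3 Prop. 1.30 and §4.3 Prop. 4.61]
[cite: Voisin2007, §3] -/
theorem exists_homeomorph_fibreOver [IsAlgClosed K] [IsDomain R] [Algebra.FiniteType K R]
    [IsSeparated S₀.hom] [LocallyOfFiniteType S₀.hom] {d : ℕ} (hd : SmoothOfRelativeDimension d S₀.hom)
    [Smooth (specOver K R).hom] [IsFinite G] [Etale G] (u v : ComplexPoints (specOver K R)) :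
    ∃ Φ : ComplexPoints (AlgPoints.fibreOver (toBase S₀ R G) u) ≃ₜ
        ComplexPoints (AlgPoints.fibreOver (toBase S₀ R G) v),
      ∀ P, AlgPoints.map (toS₀ S₀ R G) (AlgPoints.fibreOverToPoints _ v (Φ P)) =
        AlgPoints.map (toS₀ S₀ R G) (AlgPoints.fibreOverToPoints _ u P) := by
  haveI : LocallyOfFiniteType (specOver K R).hom := by
    change LocallyOfFiniteType (Spec.map (CommRingCat.ofHom (algebraMap K R)))
    rw [HasRingHomProperty.Spec_iff (P := @LocallyOfFiniteType)]
    exact RingHom.finiteType_algebraMap.mpr ‹_›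
  haveI : IrreducibleSpace (specOver K R).left := inferInstanceAs (IrreducibleSpace (PrimeSpectrum R))
  haveI : IsSeparated (specOver K R).hom :=
    inferInstanceAs (IsSeparated (Spec.map (CommRingCat.ofHom (algebraMap K R))))
  obtain ⟨r, hr⟩ := exists_smoothOfRelativeDimension_of_smooth (specOver K R).hom
  have cov : IsCoveringMap (proj S₀ R G) := isCoveringMap_proj S₀ R G hd hr
  haveI : PathConnectedSpace (ComplexPoints (specOver K R)) :=
    pathConnectedSpace_complexPoints_specOver (algebraMap K ℂ) R
  obtain ⟨Ψs, hΨs⟩ := exists_sliceHomeomorph cov u v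
  let Fu := AlgPoints.fibreHomeomorph (L := ℂ) (toBase S₀ R G) u
  let Fv := AlgPoints.fibreHomeomorph (L := ℂ) (toBase S₀ R G) v
  let su : {e : ComplexPoints (total S₀ R G) // AlgPoints.map (toBase S₀ R G) e = u} ≃ₜ
      slice (proj S₀ R G) u := Homeomorph.setCongr (slice_proj S₀ R G u).symm
  let sv : {e : ComplexPoints (total S₀ R G) // AlgPoints.map (toBase S₀ R G) e = v} ≃ₜ
      slice (proj S₀ R G) v := Homeomorph.setCongr (slice_proj S₀ R G v).symm
  refine ⟨Fu.trans (su.trans (Ψs.trans (sv.symm.trans Fv.symm))), fun P ↦ ?_⟩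
  have h1 : AlgPoints.fibreOverToPoints _ v (Fu.trans (su.trans (Ψs.trans (sv.symm.trans Fv.symm))) P) =
      (Ψs (su (Fu P))).1 := by
    rw [← AlgPoints.fibreHomeomorph_apply_coe]
    change ((Fv (Fv.symm (sv.symm (Ψs (su (Fu P)))))).1 : ComplexPoints (total S₀ R G)) = _
    rw [Homeomorph.apply_symm_apply]
    rfl
  rw [h1, ← proj_fst, hΨs, proj_fst]
  rfl

end SpreadFamily

end Family

/-! ### Weak descent of finite étale covers -/

section Main

open SpreadFamily

/-- **Finite étale covers of `S₀ ⊗_σ ℂ` come from `K` up to homeomorphism of complex points.** Let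
`K ⊆ ℂ` be algebraically closed (`σ : K → ℂ`), `S₀` a smooth irreducible quasi-projective `K`-scheme
and `g : S' → S₀ ⊗_σ ℂ` finite étale. Then there are a finite étale `g₀ : S''₀ → S₀` over `K` and a
homeomorphism `Ψ : (S''₀ ⊗_σ ℂ)(ℂ) ≃ₜ S'(ℂ)` over `(S₀ ⊗_σ ℂ)(ℂ)`, i.e. with `g (Ψ z) = (g₀ ⊗_σ ℂ) z`.
Proof: spread `g` out to a finite étale `G : X' → S₀ ×_K U` over a smooth affine `K`-variety
`U = Spec R`, `R ⊆ ℂ` (`Limits.exists_finite_etale_spread_smooth`); `S'` is the fibre of `X'` over the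
point `u₁ = (R ⊆ ℂ)` of `U(ℂ)`; take for `S''₀` the fibre over a `K`-point `u₀` of `U` (which exists as
`K = K̄`); the complex points of the two fibres are slices of the covering map
`X'(ℂ) → S₀(ℂ) × U(ℂ)` over two points of the path-connected `U(ℂ)`, hence homeomorphic over `S₀(ℂ)`
(`exists_homeomorph_fibreOver`). This is the "weak descent" input of
`HodgeTheory.finiteCovering_descends_to_qbar_of_riemannExistence_of_weakDescent`; SGA1 XIII proves
the stronger statement that `S'` itself is defined over `K`.
[cite: SGA1, Exp. XIII §4 (Cor. 4.4–Prop. 4.6)] [cite: Voisin2007, §3]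
[cite: HatcherAT2002, §1.3 Prop. 1.30] -/
theorem finiteEtaleCover_weakDescent {K : Type} [Field K] [IsAlgClosed K] (σ : K →+* ℂ)
    (S₀ : SchemeOver K) (hS₀ : HodgeTheory.IsQuasiProjectiveOver S₀)
    (hirr : IrreducibleSpace S₀.left) (hsm : Smooth S₀.hom) ⦃S' : SchemeOver ℂ⦄
    (g : S' ⟶ (baseChangeHom σ).obj S₀) (hfin : IsFinite g.left) (het : Etale g.left) :
    ∃ (S''₀ : SchemeOver K) (g₀ : S''₀ ⟶ S₀)
      (Ψ : ComplexPoints ((baseChangeHom σ).obj S''₀) ≃ₜ ComplexPoints S'),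
      IsFinite g₀.left ∧ Etale g₀.left ∧
        ∀ z, AlgPoints.map g (Ψ z) = AlgPoints.map ((baseChangeHom σ).map g₀) z := by
  letI := σ.toAlgebra
  haveI := hirr
  haveI := hsm
  haveI := hfin
  haveI := het
  haveI : IsSeparated S₀.hom := hS₀.isVarietyPair_ofScheme.isSeparated
  haveI : LocallyOfFiniteType S₀.hom := hS₀.isVarietyPair_ofScheme.locallyOfFiniteType
  haveI : QuasiCompact S₀.hom := hS₀.isVarietyPair_ofScheme.quasiCompact
  haveI : LocallyOfFinitePresentation S₀.hom :=
    locallyOfFinitePresentation_of_isLocallyNoetherian'' S₀.hom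
  obtain ⟨d, hd⟩ := exists_smoothOfRelativeDimension_of_smooth S₀.hom
  /- Step 1: spreading out `g` to `G : X' → S₀ ×_K Spec R`, `R ⊆ ℂ` smooth of finite type. -/
  obtain ⟨R, _, _, _, ψ, X', G, π, ℓ, hψ, hft, hRsm, hGfin, hGet, hℓ₁, hℓ₂, hsq⟩ :=
    Limits.exists_finite_etale_spread_smooth (K := K) (Ω := ℂ) S₀ (a := g.left)
  haveI := hft
  haveI := hRsm
  haveI := hGfin
  haveI := hGet
  haveI : LocallyOfFiniteType (specOver K R).hom := by
    change LocallyOfFiniteType (Spec.map (CommRingCat.ofHom (algebraMap K R)))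
    rw [HasRingHomProperty.Spec_iff (P := @LocallyOfFiniteType)]
    exact RingHom.finiteType_algebraMap.mpr ‹_›
  -- the projection `q : X' → Spec R`
  set q : X' ⟶ (specOver K R).left := G ≫ pullback.snd S₀.hom (specOver K R).hom with hq
  /- Step 2: the very general point `u₁ = (ψ : R ⊆ ℂ)` and a `K`-point `u₀` of `U = Spec R`. -/
  have hψU : Spec.map (CommRingCat.ofHom ψ.toRingHom) ≫ (specOver K R).hom = (specOver K ℂ).hom := by
    change Spec.map _ ≫ Spec.map _ = Spec.map _
    rw [← Spec.map_comp, ← CommRingCat.ofHom_comp]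
    exact congrArg (fun f ↦ Spec.map (CommRingCat.ofHom f)) ψ.comp_algebraMap
  let u₁ : ComplexPoints (specOver K R) := AlgPoints.mk (Spec.map (CommRingCat.ofHom ψ.toRingHom)) hψU
  obtain ⟨m, hm⟩ := Ideal.exists_maximal R
  let x : (specOver K R).left := (⟨m, hm.isPrime⟩ : PrimeSpectrum R)
  have hx : IsClosed ({x} : Set (specOver K R).left) :=
    (PrimeSpectrum.isClosed_singleton_iff_isMaximal _).mpr hm
  let u₀ : Spec (.of K) ⟶ (specOver K R).left := pointOfClosedPoint (specOver K R).hom x hx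
  have hu₀ : u₀ ≫ (specOver K R).hom = 𝟙 _ := pointOfClosedPoint_comp _ x hx
  have hKK : (specOver K K).hom = 𝟙 (Spec (.of K)) := AlgPoints.specOver_self_hom
  let u₀K : AlgPoints (specOver K R) K := AlgPoints.mk u₀ (by rw [hu₀]; exact hKK.symm)
  have hσU : (Spec.map (CommRingCat.ofHom σ) ≫ u₀) ≫ (specOver K R).hom = (specOver K ℂ).hom := by
    rw [Category.assoc, hu₀, Category.comp_id]
    rfl
  let u₀' : ComplexPoints (specOver K R) := AlgPoints.mk (Spec.map (CommRingCat.ofHom σ) ≫ u₀) hσU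
  /- Step 3: `S''₀ := X'_{u₀}`, finite étale over `S₀`. -/
  let S''₀ : SchemeOver K := AlgPoints.fibreOver (toBase S₀ R G) u₀K
  have hS''h : S''₀.hom = pullback.snd q u₀ := rfl
  have hw₀ : (pullback.fst q u₀ ≫ G ≫ pullback.fst S₀.hom (specOver K R).hom) ≫ S₀.hom = S''₀.hom := by
    rw [hS''h, Category.assoc, Category.assoc, pullback.condition, ← Category.assoc G,
      ← hq, pullback.condition_assoc, hu₀, Category.comp_id]
  let g₀ : S''₀ ⟶ S₀ := Over.homMk (pullback.fst q u₀ ≫ G ≫ pullback.fst S₀.hom (specOver K R).hom) hw₀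
  have hg₀ : g₀.left = pullback.fst q u₀ ≫ G ≫ pullback.fst S₀.hom (specOver K R).hom := rfl
  -- `g₀` is a base change of `G` along `S₀ = S₀ × {u₀} → S₀ ×_K U`
  let j : S₀.left ⟶ (S₀ ⊗ specOver K R).left :=
    pullback.lift (𝟙 _) (S₀.hom ≫ u₀) (by rw [Category.id_comp, Category.assoc, hu₀, Category.comp_id])
  have hj₁ : j ≫ pullback.fst _ _ = 𝟙 _ := pullback.lift_fst _ _ _
  have hj₂ : j ≫ pullback.snd _ _ = S₀.hom ≫ u₀ := pullback.lift_snd _ _ _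
  have tsq : IsPullback j S₀.hom (pullback.snd S₀.hom (specOver K R).hom) u₀ := by
    refine IsPullback.of_right ?_ hj₂ (IsPullback.of_hasPullback S₀.hom (specOver K R).hom)
    rw [hj₁, hu₀]
    exact IsPullback.of_horiz_isIso ⟨by rw [Category.id_comp, Category.comp_id]⟩
  have osq : IsPullback (g₀.left ≫ S₀.hom) (pullback.fst q u₀) u₀
      (G ≫ pullback.snd S₀.hom (specOver K R).hom) := by
    rw [Over.w g₀, hS''h]
    exact (IsPullback.of_hasPullback q u₀).flip
  have hcomm : g₀.left ≫ j = pullback.fst q u₀ ≫ G := by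
    apply pullback.hom_ext
    · rw [Category.assoc, hj₁, Category.comp_id, hg₀, Category.assoc]
    · rw [Category.assoc, hj₂, ← Category.assoc, Over.w g₀, hS''h, Category.assoc,
        ← pullback.condition]
  have R₁ : IsPullback g₀.left (pullback.fst q u₀) j G := IsPullback.of_right osq hcomm tsq.flip
  have hfin₀ : IsFinite g₀.left := MorphismProperty.of_isPullback (P := @IsFinite) R₁.flip hGfin
  have het₀ : Etale g₀.left := MorphismProperty.of_isPullback (P := @Etale) R₁.flip hGet
  /- Step 4: `S' ≅ X'_{u₁}` over `ℂ` and `S''₀ ⊗_σ ℂ ≅ X'_{u₀}` over `ℂ`. -/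
  have h₂ : IsPullback ℓ (pullback.snd S₀.hom (specOver K ℂ).hom)
      (pullback.snd S₀.hom (specOver K R).hom) (Spec.map (CommRingCat.ofHom ψ.toRingHom)) := by
    refine IsPullback.of_right ?_ hℓ₂ (IsPullback.of_hasPullback S₀.hom (specOver K R).hom)
    rw [hℓ₁, hψU]
    exact IsPullback.of_hasPullback S₀.hom (specOver K ℂ).hom
  have hgw : g.left ≫ pullback.snd S₀.hom (specOver K ℂ).hom = S'.hom := Over.w g
  have hP : IsPullback π S'.hom q (Spec.map (CommRingCat.ofHom ψ.toRingHom)) := by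
    have h := hsq.paste_vert h₂
    rwa [hgw] at h
  let e₁ : S' ≅ AlgPoints.fibreOver (toBase S₀ R G) u₁ :=
    Over.isoMk hP.isoPullback (hP.isoPullback_hom_snd)
  have he₁' : e₁.hom.left ≫ pullback.fst q (Spec.map (CommRingCat.ofHom ψ.toRingHom)) = π :=
    hP.isoPullback_hom_fst
  have he₁ : e₁.inv.left ≫ π = pullback.fst q (Spec.map (CommRingCat.ofHom ψ.toRingHom)) := by
    rw [← he₁', ← Category.assoc, ← Over.comp_left, e₁.inv_hom_id, Over.id_left, Category.id_comp]
  let e₀ : (baseChangeHom σ).obj S''₀ ≅ AlgPoints.fibreOver (toBase S₀ R G) u₀' :=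
    Over.isoMk (pullbackLeftPullbackSndIso q u₀ (Spec.map (CommRingCat.ofHom σ)))
      (pullbackLeftPullbackSndIso_hom_snd q u₀ (Spec.map (CommRingCat.ofHom σ)))
  have he₀ : e₀.hom.left ≫ pullback.fst q (Spec.map (CommRingCat.ofHom σ) ≫ u₀) =
      baseChangeHomFst σ S''₀ ≫ pullback.fst q u₀ :=
    pullbackLeftPullbackSndIso_hom_fst q u₀ (Spec.map (CommRingCat.ofHom σ))
  /- Step 5: moving the base point from `u₀` to `u₁`. -/
  obtain ⟨Φ, hΦ⟩ := exists_homeomorph_fibreOver S₀ R G hd u₀' u₁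
  refine ⟨S''₀, g₀, (homeomorphOfIso' e₀).trans (Φ.trans (homeomorphOfIso' e₁).symm), hfin₀, het₀,
    fun z ↦ ?_⟩
  /- Step 6: the compatibility with the projections to `(S₀ ⊗_σ ℂ)(ℂ)`. -/
  apply ComplexPoints.ext_of_left_comp_baseChangeHomFst σ S₀
  have hgfst : g.left ≫ baseChangeHomFst σ S₀ = π ≫ G ≫ pullback.fst S₀.hom (specOver K R).hom := by
    change g.left ≫ pullback.fst S₀.hom (specOver K ℂ).hom = _
    rw [← hℓ₁, ← hsq.w_assoc]
  set P₁ := Φ (homeomorphOfIso' e₀ z)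
  -- left-hand side
  have lhs : (AlgPoints.map g (((homeomorphOfIso' e₀).trans (Φ.trans (homeomorphOfIso' e₁).symm)) z)).left ≫
      baseChangeHomFst σ S₀ =
      (AlgPoints.map (toS₀ S₀ R G) (AlgPoints.fibreOverToPoints _ u₁ P₁)).left := by
    change (AlgPoints.map g (AlgPoints.map e₁.inv P₁)).left ≫ _ = _
    rw [AlgPoints.map_apply, AlgPoints.map_apply, Over.comp_left, Over.comp_left, Category.assoc,
      Category.assoc, hgfst, ← Category.assoc (e₁.inv.left), he₁, AlgPoints.map_apply, Over.comp_left,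
      AlgPoints.fibreOverToPoints_left, toS₀_left, Category.assoc]
    rfl
  -- right-hand side
  have rhs : (AlgPoints.map ((baseChangeHom σ).map g₀) z).left ≫ baseChangeHomFst σ S₀ =
      (AlgPoints.map (toS₀ S₀ R G) (AlgPoints.fibreOverToPoints _ u₀' (homeomorphOfIso' e₀ z))).left := by
    have e1 : (AlgPoints.map ((baseChangeHom σ).map g₀) z).left ≫ baseChangeHomFst σ S₀ =
        z.left ≫ baseChangeHomFst σ S''₀ ≫ g₀.left := by
      rw [AlgPoints.map_apply, Over.comp_left, Category.assoc, baseChangeHom_map_left_comp_fst]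
    have e2 : (AlgPoints.map (toS₀ S₀ R G)
        (AlgPoints.fibreOverToPoints _ u₀' (homeomorphOfIso' e₀ z))).left =
        ((z.left ≫ e₀.hom.left) ≫ pullback.fst q (Spec.map (CommRingCat.ofHom σ) ≫ u₀)) ≫
          (G ≫ pullback.fst S₀.hom (specOver K R).hom) := rfl
    rw [e1, e2, hg₀]
    simp only [Category.assoc]
    rw [reassoc_of% he₀]
  rw [lhs, rhs, hΦ]

end Main



end Literature.AlgebraicGeometry.FundamentalGroup

end
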